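import Mathlib.Analysis.Complex.JensenFormula
import Mathlib.Analysis.Complex.Poisson
import Mathlib.Analysis.Complex.Harmonic.Poisson
import Mathlib.MeasureTheory.Integral.CircleIntegral
import Mathlib.MeasureTheory.Integral.CircleAverage
import Mathlib.Analysis.SpecialFunctions.Log.PosLog
import Mathlib.Tactic
import HarnessLib

/-!
# Nevanlinna's lemma: `φ = v/u` with `sup|u|, sup|v| ≤ exp T(φ)` (for CDT Appendix §17)

Calegari–Dimitrov–Tang, arXiv:2408.15403, Appendix §17 (p. 130), last paragraph of the proof of
the basic holonomy bound eq. (17.1) = (basic basic):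
"A well-known lemma of Nevanlinna (cf. [Nevanlinna] or [Goluzin]), based on the canonical
Blaschke products and the canonical decomposition `log = log⁺ − log⁻` in the Poisson–Jensen
formula, constructs on the open disc `𝔻` a quotient representation `φ = v/u` with `u(0) = 1` and
with both `sup_𝔻 |u|` and `sup_𝔻 |v|` bounded by `exp(T(φ))`",
`T(φ) = ∫_𝕋 log⁺|φ| dμ + Σ_{poles ρ ∈ 𝔻} log(1/|ρ|)` (eq. (17.2)).

This file proves that lemma on a disc of any radius `R > 0` (all statements for the circle
`|z| = R`; the application dilates `R ↓ 1`):

* `HolonomyBound.schwarzIntegral` — the Schwarz integral `S(w) = ⨍ (z+w)/(z−w) k(z)` of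
  continuous boundary data `k`; `differentiableOn_schwarzIntegral` (holomorphic in `|w| < R`, via
  the Cauchy-integral power series), `re_schwarzIntegral` (real part = Poisson integral),
  `re_schwarzIntegral_nonneg`, `schwarzIntegral_zero` (`S(0) = ⨍ k`).
* `HolonomyBound.log_norm_le_circleAverage_of_analyticOnNhd` — the **Poisson–Jensen inequality**
  `log|f(w)| ≤ ⨍ Re((z+w)/(z−w)) log|f(z)|` for `f` holomorphic on `|z| ≤ R` with `f(w) ≠ 0`
  (zeros split off by `MeromorphicOn.extract_zeros_poles`; an interior zero `u` contributes
  `log|w−u| ≤ ⨍ P·log|·−u|` by comparison with the harmonic function `log|R² − ūz| − log R`,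
  i.e. the Blaschke bound `R|w−u| ≤ |R² − ūw|`; boundary zeros by Mathlib's
  `circleAverage_re_herglotzRieszKernel_mul_log`; the zero-free part by the Poisson formula for
  the harmonic `log|g|`).
* `HolonomyBound.blaschkeProd` — finite Blaschke products `Π (R(z−u)/(R²−ūz))^{n(u)}`: modulus
  `≤ 1` on the disc, `= 1` on the circle, `log|B(0)| = −Σ n(u) log(R/|u|)`, analytic on the
  closed disc.
* `HolonomyBound.exists_quotient_rep_of_analyticOnNhd` — **Nevanlinna's lemma, holomorphic
  case**: `u = exp(m − S)`, `v = φu`, `|u|, |v| ≤ exp(m)`, `m = ⨍_{|z|=R} log⁺|φ|`.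
* `HolonomyBound.exists_quotient_rep_of_meromorphic` — **Nevanlinna's lemma, meromorphic case**
  `φ = ψ/χ` (`χ(0) ≠ 0`, `χ ≠ 0` on `|z| = R`): `φ = v/u` near `0`, `u(0) = 1`,
  `|u|, |v| ≤ exp(⨍ log⁺|φ| + Σ_x (D x)⁻ log(R/|x|))` on `|z| < R`, `D` the divisor of `φ` on
  `|z| ≤ R` (`u = B/B(0)·exp(m − S)` with `B` the Blaschke product of the poles,
  `v = F/B(0)·exp(m − S)` with `F = φB` made holomorphic by the extracted factorisation).

No named facts. (The holonomy bounds with `T(φ)` built on this are in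
`HolonomyBoundCharacteristic.lean`.)

## References

* [CalegariDimitrovTang2024] arXiv:2408.15403, Appendix §17, eq. (17.2) and p. 130.
* R. Nevanlinna, *Le théorème de Picard–Borel et la théorie des fonctions méromorphes* (1929),
  Ch. I; G. M. Goluzin, *Geometric theory of functions of a complex variable*, Ch. VII §1.
-/

noncomputable section

open Filter MeromorphicAt MeasureTheory MeromorphicOn Metric Real Set Topology InnerProductSpace
  Complex
open scoped ComplexConjugate

namespace Literature.NumberTheory.Transcendental

namespace HolonomyBound

/-! ### Blaschke factors `R(z − u)/(R² − ū z)` -/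

/-- `R ‖w − u‖ ≤ ‖R² − ū w‖` for `u, w` in the closed disc of radius `R` (the Blaschke factor
`R(z − u)/(R² − ū z)` has modulus `≤ 1` on the disc): `‖R² − ūw‖² − R²‖w−u‖² = (R² − |u|²)(R² − |w|²)`.
[folklore] -/
theorem mul_norm_sub_le_norm_blaschkeDen {R : ℝ} (hR : 0 ≤ R) {u w : ℂ} (hu : ‖u‖ ≤ R)
    (hw : ‖w‖ ≤ R) : R * ‖w - u‖ ≤ ‖(R : ℂ) ^ 2 - conj u * w‖ := by
  have key : ‖(R : ℂ) ^ 2 - conj u * w‖ ^ 2 - (R * ‖w - u‖) ^ 2 =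
      (R ^ 2 - ‖u‖ ^ 2) * (R ^ 2 - ‖w‖ ^ 2) := by
    rw [mul_pow, Complex.sq_norm, Complex.sq_norm, Complex.sq_norm, Complex.sq_norm,
      Complex.normSq_apply, Complex.normSq_apply, Complex.normSq_apply, Complex.normSq_apply]
    simp only [Complex.sub_re, Complex.sub_im, Complex.mul_re, Complex.mul_im, Complex.conj_re,
      Complex.conj_im, ← Complex.ofReal_pow, Complex.ofReal_re, Complex.ofReal_im]
    ring
  have h1 : 0 ≤ (R ^ 2 - ‖u‖ ^ 2) * (R ^ 2 - ‖w‖ ^ 2) :=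
    mul_nonneg (by nlinarith [norm_nonneg u]) (by nlinarith [norm_nonneg w])
  have h2 : (R * ‖w - u‖) ^ 2 ≤ ‖(R : ℂ) ^ 2 - conj u * w‖ ^ 2 := by linarith
  exact (pow_le_pow_iff_left₀ (by positivity) (norm_nonneg _) two_ne_zero).mp h2

/-- On the circle `|z| = R`: `‖R² − ū z‖ = R ‖z − u‖` (Blaschke factors are unimodular there).
[folklore] -/
theorem norm_blaschkeDen_of_mem_sphere {R : ℝ} {u z : ℂ} (hz : ‖z‖ = R) :
    ‖(R : ℂ) ^ 2 - conj u * z‖ = R * ‖z - u‖ := by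
  have h1 : (R : ℂ) ^ 2 = z * conj z := by
    rw [Complex.mul_conj, Complex.normSq_eq_norm_sq, hz]; push_cast; ring
  have h2 : (R : ℂ) ^ 2 - conj u * z = z * conj (z - u) := by rw [h1, map_sub]; ring
  rw [h2, norm_mul, Complex.norm_conj, hz]

/-- The denominator `R² − ū z` of a Blaschke factor does not vanish on the closed disc when
`|u| < R`. [folklore] -/
theorem blaschkeDen_ne_zero {R : ℝ} {u z : ℂ} (hu : ‖u‖ < R) (hz : ‖z‖ ≤ R) :
    (R : ℂ) ^ 2 - conj u * z ≠ 0 := by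
  have hR : 0 < R := lt_of_le_of_lt (norm_nonneg u) hu
  intro h0
  have h1 : ‖conj u * z‖ < R ^ 2 := by
    rw [norm_mul, Complex.norm_conj]
    have : ‖u‖ * ‖z‖ ≤ ‖u‖ * R := by gcongr
    nlinarith [norm_nonneg u, norm_nonneg z]
  have h2 : ‖(R : ℂ) ^ 2‖ = R ^ 2 := by
    rw [← Complex.ofReal_pow, Complex.norm_real, Real.norm_of_nonneg (by positivity)]
  rw [sub_eq_zero] at h0
  rw [← h0, h2] at h1
  exact lt_irrefl _ h1

/-! ### Finite Blaschke products -/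

/-- The finite Blaschke product `Π_{u ∈ s} (R(z − u)/(R² − ū z))^{n u}` for the disc `|z| < R`.
[folklore] -/
def blaschkeProd (R : ℝ) (s : Finset ℂ) (n : ℂ → ℕ) (z : ℂ) : ℂ :=
  ∏ u ∈ s, ((R : ℂ) * (z - u) / ((R : ℂ) ^ 2 - conj u * z)) ^ n u

section Blaschke

variable {R : ℝ} {s : Finset ℂ} {n : ℂ → ℕ}

/-- A Blaschke product has modulus `≤ 1` on the closed disc. [folklore] -/
theorem norm_blaschkeProd_le_one (hR : 0 < R) (hs : ∀ u ∈ s, ‖u‖ < R) {z : ℂ}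
    (hz : ‖z‖ ≤ R) : ‖blaschkeProd R s n z‖ ≤ 1 := by
  unfold blaschkeProd
  rw [norm_prod]
  refine Finset.prod_le_one (fun u _ => norm_nonneg _) fun u hu => ?_
  rw [norm_pow]
  refine pow_le_one₀ (norm_nonneg _) ?_
  rw [norm_div, div_le_one (norm_pos_iff.mpr (blaschkeDen_ne_zero (hs u hu) hz)), norm_mul,
    Complex.norm_real, Real.norm_of_nonneg hR.le]
  exact mul_norm_sub_le_norm_blaschkeDen hR.le (hs u hu).le hz

/-- A Blaschke product has modulus `1` on the circle `|z| = R`. [folklore] -/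
theorem norm_blaschkeProd_eq_one (hR : 0 < R) (hs : ∀ u ∈ s, ‖u‖ < R) {z : ℂ}
    (hz : ‖z‖ = R) : ‖blaschkeProd R s n z‖ = 1 := by
  unfold blaschkeProd
  rw [norm_prod]
  refine Finset.prod_eq_one fun u hu => ?_
  have hzu : z ≠ u := by rintro rfl; linarith [hs z hu]
  rw [norm_pow, norm_div, norm_blaschkeDen_of_mem_sphere hz, norm_mul, Complex.norm_real,
    Real.norm_of_nonneg hR.le, div_self (mul_ne_zero hR.ne' (norm_ne_zero_iff.mpr
      (sub_ne_zero.mpr hzu))), one_pow]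

/-- The value of a Blaschke product at the centre: `|B(0)| = Π (|u|/R)^{n u}`. [folklore] -/
theorem norm_blaschkeProd_zero (hR : 0 < R) :
    ‖blaschkeProd R s n 0‖ = ∏ u ∈ s, (‖u‖ / R) ^ n u := by
  unfold blaschkeProd
  rw [norm_prod]
  refine Finset.prod_congr rfl fun u _ => ?_
  rw [norm_pow, zero_sub, mul_zero, sub_zero, norm_div, norm_mul, norm_neg, Complex.norm_real,
    Real.norm_of_nonneg hR.le, ← Complex.ofReal_pow, Complex.norm_real,
    Real.norm_of_nonneg (by positivity)]
  congr 1
  field_simp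

/-- `log |B(0)| = −Σ n u · log(R/|u|)` when no `u` is `0`. [folklore] -/
theorem log_norm_blaschkeProd_zero (hR : 0 < R) (hs0 : ∀ u ∈ s, u ≠ 0) :
    Real.log ‖blaschkeProd R s n 0‖ = -∑ u ∈ s, n u * Real.log (R / ‖u‖) := by
  rw [norm_blaschkeProd_zero hR, Real.log_prod]
  · rw [← Finset.sum_neg_distrib]
    refine Finset.sum_congr rfl fun u hu => ?_
    have hu0 : 0 < ‖u‖ := norm_pos_iff.mpr (hs0 u hu)
    rw [Real.log_pow, Real.log_div hu0.ne' hR.ne', Real.log_div hR.ne' hu0.ne']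
    ring
  · intro u hu
    exact pow_ne_zero _ (div_ne_zero (norm_ne_zero_iff.mpr (hs0 u hu)) hR.ne')

/-- A Blaschke product does not vanish at the centre when no `u` is `0`. [folklore] -/
theorem blaschkeProd_zero_ne_zero (hR : 0 < R) (hs : ∀ u ∈ s, ‖u‖ < R) (hs0 : ∀ u ∈ s, u ≠ 0) :
    blaschkeProd R s n 0 ≠ 0 := by
  unfold blaschkeProd
  refine Finset.prod_ne_zero_iff.mpr fun u hu => pow_ne_zero _ ?_
  refine div_ne_zero (mul_ne_zero (by exact_mod_cast hR.ne') (by simpa using hs0 u hu)) ?_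
  exact blaschkeDen_ne_zero (hs u hu) (by simpa using hR.le)

/-- A Blaschke product is analytic at every point of the closed disc. [folklore] -/
theorem analyticAt_blaschkeProd (hs : ∀ u ∈ s, ‖u‖ < R) {z : ℂ} (hz : ‖z‖ ≤ R) :
    AnalyticAt ℂ (blaschkeProd R s n) z := by
  unfold blaschkeProd
  have : (fun z => ∏ u ∈ s, ((R : ℂ) * (z - u) / ((R : ℂ) ^ 2 - conj u * z)) ^ n u) =
      ∏ u ∈ s, fun z => ((R : ℂ) * (z - u) / ((R : ℂ) ^ 2 - conj u * z)) ^ n u := by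
    funext z; simp [Finset.prod_apply]
  rw [this]
  refine Finset.analyticAt_prod _ fun u hu => ?_
  refine ((analyticAt_const.mul (analyticAt_id.sub analyticAt_const)).div
    (analyticAt_const.sub (analyticAt_const.mul analyticAt_id)) ?_).pow _
  exact blaschkeDen_ne_zero (hs u hu) hz




end Blaschke

/-- The Schwarz integral of real boundary data `k` on the circle `|z| = R`:
`S(w) = ⨍ (z + w)/(z − w) · k(z)`, a holomorphic function of `w` in the disc whose real part is
the Poisson integral of `k`. [folklore] -/
def schwarzIntegral (k : ℂ → ℝ) (R : ℝ) (w : ℂ) : ℂ :=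
  circleAverage (fun z => herglotzRieszKernel 0 w z * (k z : ℂ)) 0 R

variable {k : ℂ → ℝ} {R : ℝ} {w : ℂ}

/-- The Schwarz integral as a Cauchy-type integral minus a constant. [folklore] -/
theorem schwarzIntegral_eq_cauchy (hR : 0 < R) (hk : ContinuousOn k (sphere (0 : ℂ) R))
    (hw : w ∈ ball (0 : ℂ) R) :
    schwarzIntegral k R w =
      (2 * π * I)⁻¹ • (∮ z in C(0, R), (z - w)⁻¹ • (2 * (k z : ℂ))) -
        (2 * π * I)⁻¹ • (∮ z in C(0, R), z⁻¹ • (k z : ℂ)) := by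
  unfold schwarzIntegral
  rw [circleAverage_eq_circleIntegral hR.ne', ← smul_sub]
  congr 1
  have hw' : ‖w‖ < R := by simpa using hw
  have hsphere : ∀ z ∈ sphere (0 : ℂ) R, z ≠ 0 ∧ z - w ≠ 0 := by
    intro z hz
    have hz' : ‖z‖ = R := by simpa using hz
    refine ⟨?_, ?_⟩
    · rintro rfl; simp at hz'; linarith
    · intro h
      rw [sub_eq_zero] at h
      rw [h] at hz'
      linarith
  have hkc : ContinuousOn (fun z => (k z : ℂ)) (sphere (0 : ℂ) R) :=
    continuous_ofReal.comp_continuousOn hk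
  have hi1 : CircleIntegrable (fun z => (z - w)⁻¹ • (2 * (k z : ℂ))) 0 R := by
    apply ContinuousOn.circleIntegrable hR.le
    change ContinuousOn (fun z => (z - w)⁻¹ * (2 * (k z : ℂ))) (sphere (0 : ℂ) R)
    refine ContinuousOn.mul ?_ (continuousOn_const.mul hkc)
    exact ContinuousOn.inv₀ (continuousOn_id.sub continuousOn_const) fun z hz => (hsphere z hz).2
  have hi2 : CircleIntegrable (fun z => z⁻¹ • (k z : ℂ)) 0 R := by
    apply ContinuousOn.circleIntegrable hR.le
    change ContinuousOn (fun z => z⁻¹ * (k z : ℂ)) (sphere (0 : ℂ) R)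
    refine ContinuousOn.mul ?_ hkc
    exact ContinuousOn.inv₀ continuousOn_id fun z hz => (hsphere z hz).1
  rw [← circleIntegral.integral_sub hi1 hi2]
  refine circleIntegral.integral_congr hR.le fun z hz => ?_
  obtain ⟨hz0, hzw⟩ := hsphere z hz
  simp only [herglotzRieszKernel, sub_zero, smul_eq_mul]
  field_simp
  ring

/-- The Schwarz integral of continuous boundary data is holomorphic in the open disc. [folklore] -/
theorem differentiableOn_schwarzIntegral (hR : 0 < R) (hk : ContinuousOn k (sphere (0 : ℂ) R)) :
    DifferentiableOn ℂ (schwarzIntegral k R) (ball (0 : ℂ) R) := by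
  set R' : NNReal := ⟨R, hR.le⟩ with hR'
  have hRR : (R' : ℝ) = R := rfl
  have hkc : ContinuousOn (fun z => (k z : ℂ)) (sphere (0 : ℂ) R) :=
    continuous_ofReal.comp_continuousOn hk
  have hint : CircleIntegrable (fun z => (2 * (k z : ℂ))) 0 R' :=
    ContinuousOn.circleIntegrable hR.le (continuousOn_const.mul hkc)
  have hF := hasFPowerSeriesOn_cauchy_integral hint (by exact_mod_cast hR)
  have hFd : DifferentiableOn ℂ
      (fun w => (2 * π * I)⁻¹ • (∮ z in C(0, R), (z - w)⁻¹ • (2 * (k z : ℂ)))) (ball (0 : ℂ) R) := by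
    have := hF.differentiableOn
    rwa [Metric.eball_coe] at this
  have hG : DifferentiableOn ℂ (fun w : ℂ => (2 * π * I)⁻¹ • (∮ z in C(0, R), (z - w)⁻¹ • (2 * (k z : ℂ))) -
      (2 * π * I)⁻¹ • (∮ z in C(0, R), z⁻¹ • (k z : ℂ))) (ball (0 : ℂ) R) :=
    hFd.sub (differentiableOn_const _)
  refine hG.congr fun w hw => ?_
  exact schwarzIntegral_eq_cauchy hR hk hw

/-- The real part of the Schwarz integral is the Poisson integral. [folklore] -/
theorem re_schwarzIntegral (hR : 0 < R) (hk : ContinuousOn k (sphere (0 : ℂ) R))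
    (hw : w ∈ ball (0 : ℂ) R) :
    (schwarzIntegral k R w).re =
      circleAverage (fun z => (herglotzRieszKernel 0 w z).re * k z) 0 R := by
  unfold schwarzIntegral
  have hsphere : ∀ z ∈ sphere (0 : ℂ) |R|, z - w ≠ 0 := by
    intro z hz h
    have hz' : ‖z‖ = R := by simpa [abs_of_pos hR] using hz
    have hw' : ‖w‖ < R := by simpa using hw
    rw [sub_eq_zero] at h; rw [h] at hz'; linarith
  have hcont : ContinuousOn (fun z => herglotzRieszKernel 0 w z * (k z : ℂ)) (sphere (0 : ℂ) |R|) := by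
    refine ContinuousOn.mul ?_ (continuous_ofReal.comp_continuousOn (by rwa [abs_of_pos hR]))
    simp only [herglotzRieszKernel_fun_def, sub_zero]
    exact (continuousOn_id.add continuousOn_const).div (continuousOn_id.sub continuousOn_const)
      hsphere
  have hci : CircleIntegrable (fun z => herglotzRieszKernel 0 w z * (k z : ℂ)) 0 R :=
    hcont.circleIntegrable'
  have h := reCLM.circleAverage_comp_comm hci
  simp only [reCLM_apply] at h
  rw [← h]
  congr 1
  funext z
  simp only [Function.comp_apply, reCLM_apply, Complex.re_mul_ofReal]



/-! ### A Poisson–Jensen inequality -/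

/-- The Poisson integral of `log|· − u|` dominates `log|w − u|` for `u` inside the disc:
`log ‖w − u‖ ≤ ⨍ Re((z+w)/(z−w)) log ‖z − u‖` (`|u|, |w| < R`, `w ≠ u`). [folklore] -/
theorem log_norm_sub_le_circleAverage {R : ℝ} {u w : ℂ} (hu : u ∈ ball (0 : ℂ) R)
    (hw : w ∈ ball (0 : ℂ) R) (hwu : w ≠ u) :
    Real.log ‖w - u‖ ≤
      circleAverage ((Complex.re ∘ herglotzRieszKernel 0 w) * (Real.log ‖· - u‖)) 0 R := by
  have hR : 0 < R := pos_of_mem_ball hw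
  have hu' : ‖u‖ < R := by simpa using hu
  have hw' : ‖w‖ < R := by simpa using hw
  -- the harmonic comparison function `h(z) = log ‖R² − ū z‖ − log R`
  set h : ℂ → ℝ := fun z => Real.log ‖(R : ℂ) ^ 2 - conj u * z‖ - Real.log R with hh
  have hne : ∀ z ∈ closedBall (0 : ℂ) R, (R : ℂ) ^ 2 - conj u * z ≠ 0 := by
    intro z hz h0
    have hz' : ‖z‖ ≤ R := by simpa using hz
    have h1 : ‖conj u * z‖ < R ^ 2 := by
      rw [norm_mul, Complex.norm_conj]
      have : ‖u‖ * ‖z‖ ≤ ‖u‖ * R := by gcongr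
      nlinarith [norm_nonneg u, norm_nonneg z]
    have h2 : ‖(R : ℂ) ^ 2‖ = R ^ 2 := by
      rw [← Complex.ofReal_pow, Complex.norm_real, Real.norm_of_nonneg (by positivity)]
    rw [sub_eq_zero] at h0
    rw [← h0, h2] at h1
    exact lt_irrefl _ h1
  have hharm : HarmonicOnNhd h (closedBall (0 : ℂ) R) := by
    intro z hz
    have h1 : HarmonicAt (Real.log ‖(fun z : ℂ => (R : ℂ) ^ 2 - conj u * z) ·‖) z :=
      AnalyticAt.harmonicAt_log_norm (by fun_prop) (hne z hz)
    exact h1.sub (harmonicAt_const _)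
  have hP := hharm.circleAverage_re_herglotzRieszKernel_smul hw
  -- on the circle, `h = log ‖· − u‖`
  have hsph : EqOn ((Complex.re ∘ herglotzRieszKernel 0 w) * (Real.log ‖· - u‖))
      ((Complex.re ∘ herglotzRieszKernel 0 w) • h) (sphere (0 : ℂ) |R|) := by
    intro z hz
    have hz' : ‖z‖ = R := by simpa [abs_of_pos hR] using hz
    have hzu : z ≠ u := by rintro rfl; linarith
    simp only [Pi.mul_apply, Pi.smul_apply', smul_eq_mul, Function.comp_apply, hh]
    congr 1
    rw [norm_blaschkeDen_of_mem_sphere hz',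
      Real.log_mul hR.ne' (norm_ne_zero_iff.mpr (sub_ne_zero.mpr hzu))]
    ring
  rw [circleAverage_congr_sphere hsph, hP, hh]
  -- `h w ≥ log ‖w − u‖`
  have hpos : 0 < ‖w - u‖ := norm_pos_iff.mpr (sub_ne_zero.mpr hwu)
  have hle := mul_norm_sub_le_norm_blaschkeDen hR.le hu'.le hw'.le
  have hlog := Real.log_le_log (by positivity) hle
  rw [Real.log_mul hR.ne' hpos.ne'] at hlog
  simp only
  linarith

/-- **Poisson–Jensen inequality** for a holomorphic function on the closed disc `|z| ≤ R`
(not identically zero): for `|w| < R` with `f(w) ≠ 0`,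
`log ‖f w‖ ≤ ⨍ Re((z+w)/(z−w)) log ‖f z‖` (equality iff `f` has no zeros in the open disc;
the defect is `Σ_zeros log` of Blaschke factors). [folklore] -/
theorem log_norm_le_circleAverage_of_analyticOnNhd {f : ℂ → ℂ} {R : ℝ}
    (hf : AnalyticOnNhd ℂ f (closedBall (0 : ℂ) R))
    (hf' : ∀ u ∈ closedBall (0 : ℂ) R, meromorphicOrderAt f u ≠ ⊤)
    {w : ℂ} (hw : w ∈ ball (0 : ℂ) R) (hfw : f w ≠ 0) :
    Real.log ‖f w‖ ≤
      circleAverage ((Complex.re ∘ herglotzRieszKernel 0 w) * (Real.log ‖f ·‖)) 0 R := by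
  classical
  have hR : 0 < R := pos_of_mem_ball hw
  have hw' : ‖w‖ < R := by simpa using hw
  set CB := closedBall (0 : ℂ) R with hCB
  have hwCB : w ∈ CB := ball_subset_closedBall hw
  have h₁f : MeromorphicOn f CB := hf.meromorphicOn
  set D := MeromorphicOn.divisor f CB with hDdef
  have hD : D.support.Finite := D.finiteSupport (isCompact_closedBall 0 R)
  obtain ⟨g, h₁g, h₂g, h₃g⟩ := h₁f.extract_zeros_poles (fun u => hf' u u.2) hD
  have h₄g := MeromorphicOn.extract_zeros_poles_log h₂g h₃g
  -- the divisor: nonnegative, vanishing at `w`, supported in `CB`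
  have hD0 : ∀ u, 0 ≤ D u := fun u => by
    have h := hf.divisor_nonneg
    exact h u
  have hDw : D w = 0 := by
    rw [hDdef, MeromorphicOn.divisor_apply h₁f hwCB,
      ((hf w hwCB).meromorphicNFAt.meromorphicOrderAt_eq_zero_iff).mpr hfw]
    rfl
  have hDsupp : ∀ u ∈ hD.toFinset, u ∈ CB ∧ u ≠ w := by
    intro u hu
    rw [Set.Finite.mem_toFinset] at hu
    refine ⟨D.supportWithinDomain hu, ?_⟩
    rintro rfl
    exact hu hDw
  -- (i) the value at `w`
  have hacc : AccPt w (𝓟 CB) := by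
    apply accPt_iff_frequently_nhdsNE.mpr
    apply compl_notMem
    apply mem_nhdsWithin.mpr
    use ball 0 R
    simpa [hw] using! fun _ ⟨h, _⟩ ↦ ball_subset_closedBall h
  have hval : Real.log ‖f w‖ = ∑ᶠ u, (D u : ℝ) * Real.log ‖w - u‖ + Real.log ‖g w‖ := by
    have h := MeromorphicOn.log_norm_meromorphicTrailingCoeffAt_extract_zeros_poles (D := D) hD
      hwCB hacc (h₁f w hwCB) (h₁g w hwCB) (h₂g ⟨w, hwCB⟩) h₃g
    rwa [(hf w hwCB).meromorphicTrailingCoeffAt_of_ne_zero hfw] at h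
  -- (ii) the circle-average side
  set K : ℂ → ℝ := Complex.re ∘ herglotzRieszKernel 0 w with hK
  have hKcont : ContinuousOn K (sphere (0 : ℂ) |R|) := by
    have hsphere : ∀ z ∈ sphere (0 : ℂ) |R|, z - w ≠ 0 := by
      intro z hz h
      have hz' : ‖z‖ = R := by simpa [abs_of_pos hR] using hz
      rw [sub_eq_zero] at h; rw [h] at hz'; linarith
    simp only [hK, herglotzRieszKernel_fun_def, sub_zero]
    refine Complex.continuous_re.comp_continuousOn ?_
    exact (continuousOn_id.add continuousOn_const).div (continuousOn_id.sub continuousOn_const)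
      hsphere
  -- integrability of `K * log ‖· − u‖` and of `K * log ‖g‖`
  have hKint : ∀ u : ℂ, CircleIntegrable (K * (Real.log ‖· - u‖)) 0 R := by
    intro u
    have h1 : CircleIntegrable (Real.log ‖· - u‖) 0 R := circleIntegrable_log_norm_sub_const R
    unfold CircleIntegrable at h1 ⊢
    have h2 : ContinuousOn (fun θ : ℝ => K (circleMap 0 R θ)) (Set.uIcc 0 (2 * π)) := by
      refine hKcont.comp_continuous (continuous_circleMap 0 R) (fun θ => ?_) |>.continuousOn
      simp [abs_of_pos hR]
    exact h1.continuousOn_mul h2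
  have hKg : CircleIntegrable (K * (Real.log ‖g ·‖)) 0 R := by
    apply ContinuousOn.circleIntegrable'
    refine hKcont.mul ?_
    refine ContinuousOn.log ?_ fun z hz => ?_
    · exact (h₁g.continuousOn.norm).mono (by rw [abs_of_pos hR]; exact sphere_subset_closedBall)
    · rw [abs_of_pos hR] at hz
      exact norm_ne_zero_iff.mpr (h₂g ⟨z, sphere_subset_closedBall hz⟩)
  -- rewrite the integrand codiscretely
  have hcod : (K * (Real.log ‖f ·‖)) =ᶠ[codiscreteWithin (sphere (0 : ℂ) |R|)]
      (K * (∑ᶠ u, ((D u : ℝ) * Real.log ‖· - u‖)) + K * (Real.log ‖g ·‖)) := by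
    have h1 : (K * (Real.log ‖f ·‖)) =ᶠ[codiscreteWithin CB]
        (K * (∑ᶠ u, ((D u : ℝ) * Real.log ‖· - u‖)) + K * (Real.log ‖g ·‖)) := by
      filter_upwards [h₄g] with z hz
      simp only [Pi.mul_apply, Pi.add_apply, hz]
      ring
    refine codiscreteWithin_mono ?_ h1
    rw [abs_of_pos hR]
    exact sphere_subset_closedBall
  rw [circleAverage_congr_codiscreteWithin hcod hR.ne']
  -- the finsum is a finite sum over `s = supp D`
  set s := hD.toFinset with hs
  have hfin : (∑ᶠ u, ((D u : ℝ) * Real.log ‖· - u‖) : ℂ → ℝ) =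
      ∑ u ∈ s, fun z => (D u : ℝ) * Real.log ‖z - u‖ := by
    apply finsum_eq_sum_of_support_subset
    intro u hu
    rw [Finset.mem_coe, hs, Set.Finite.mem_toFinset]
    intro hDu
    apply hu
    funext z
    simp [hDu]
  have hfin' : ∑ᶠ u, (D u : ℝ) * Real.log ‖w - u‖ = ∑ u ∈ s, (D u : ℝ) * Real.log ‖w - u‖ := by
    apply finsum_eq_sum_of_support_subset
    intro u hu
    rw [Finset.mem_coe, hs, Set.Finite.mem_toFinset]
    intro hDu
    apply hu
    simp [hDu]
  rw [hfin, Finset.mul_sum]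
  have hKint' : ∀ u ∈ s, CircleIntegrable (K * fun z => (D u : ℝ) * Real.log ‖z - u‖) 0 R := by
    intro u _
    have : (K * fun z => (D u : ℝ) * Real.log ‖z - u‖) = (D u : ℝ) • (K * (Real.log ‖· - u‖)) := by
      funext z; simp only [Pi.mul_apply, Pi.smul_apply, smul_eq_mul]; ring
    rw [this]
    exact (hKint u).const_smul
  have hsumint : CircleIntegrable (∑ u ∈ s, K * fun z => (D u : ℝ) * Real.log ‖z - u‖) 0 R :=
    CircleIntegrable.sum s hKint'
  rw [circleAverage_add hsumint hKg, circleAverage_sum hKint']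
  -- evaluate / estimate each term
  have hterm : ∀ u ∈ s, (D u : ℝ) * Real.log ‖w - u‖ ≤
      circleAverage (K * fun z => (D u : ℝ) * Real.log ‖z - u‖) 0 R := by
    intro u hu
    obtain ⟨huCB, huw⟩ := hDsupp u hu
    have : (K * fun z => (D u : ℝ) * Real.log ‖z - u‖) = (D u : ℝ) • (K * (Real.log ‖· - u‖)) := by
      funext z; simp only [Pi.mul_apply, Pi.smul_apply, smul_eq_mul]; ring
    rw [this, circleAverage_smul, smul_eq_mul]
    refine mul_le_mul_of_nonneg_left ?_ (by exact_mod_cast hD0 u)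
    have hu' : ‖u‖ ≤ R := by simpa [hCB] using huCB
    rcases hu'.lt_or_eq with hlt | heq
    · exact log_norm_sub_le_circleAverage (by simpa using hlt) hw huw.symm
    · have husph : u ∈ sphere (0 : ℂ) R := by simpa using heq
      rw [hK, circleAverage_re_herglotzRieszKernel_mul_log husph hw]
  have hgterm : circleAverage (K * (Real.log ‖g ·‖)) 0 R = Real.log ‖g w‖ := by
    have hharm : HarmonicOnNhd (Real.log ‖g ·‖) (closedBall (0 : ℂ) R) :=
      fun z hz => (h₁g z hz).harmonicAt_log_norm (h₂g ⟨z, hz⟩)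
    exact hharm.circleAverage_re_herglotzRieszKernel_smul hw
  rw [hval, hfin', hgterm]
  have := Finset.sum_le_sum hterm
  linarith


/-! ### Nevanlinna's lemma, holomorphic case -/

variable {k : ℂ → ℝ} {R : ℝ} {w : ℂ} in
/-- The real part of the Schwarz integral of nonnegative data is nonnegative. [folklore] -/
theorem re_schwarzIntegral_nonneg (hR : 0 < R) (hk : ContinuousOn k (sphere (0 : ℂ) R))
    (hk0 : ∀ z ∈ sphere (0 : ℂ) R, 0 ≤ k z) (hw : w ∈ ball (0 : ℂ) R) :
    0 ≤ (schwarzIntegral k R w).re := by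
  rw [re_schwarzIntegral hR hk hw]
  refine circleAverage_nonneg_of_nonneg fun z hz => ?_
  rw [abs_of_pos hR] at hz
  refine mul_nonneg ?_ (hk0 z hz)
  have h := le_re_herglotzRieszKernel (c := 0) hz hw
  simp only [sub_zero] at h
  rw [herglotzRieszKernel_def]
  simp only [sub_zero]
  refine le_trans ?_ h
  have hw' : ‖w‖ < R := by simpa using hw
  exact div_nonneg (by linarith) (by positivity)

variable {k : ℂ → ℝ} {R : ℝ} in
/-- The Schwarz integral at the centre is the mean of the data. [folklore] -/
theorem schwarzIntegral_zero (hR : 0 < R) (hk : ContinuousOn k (sphere (0 : ℂ) R)) :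
    schwarzIntegral k R 0 = ((circleAverage k 0 R : ℝ) : ℂ) := by
  unfold schwarzIntegral
  have h1 : EqOn (fun z => herglotzRieszKernel 0 0 z * (k z : ℂ)) (fun z => ((k z : ℝ) : ℂ))
      (sphere (0 : ℂ) |R|) := by
    intro z hz
    have hz' : ‖z‖ = R := by simpa [abs_of_pos hR] using hz
    have hz0 : z ≠ 0 := by rintro rfl; simp at hz'; linarith
    simp only [herglotzRieszKernel, sub_zero, add_zero, div_self hz0, one_mul]
  rw [circleAverage_congr_sphere h1]
  have hci : CircleIntegrable k 0 R := by
    apply ContinuousOn.circleIntegrable'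
    rwa [abs_of_pos hR]
  have h := Complex.ofRealCLM.circleAverage_comp_comm hci
  have hfun : (fun z => ((k z : ℝ) : ℂ)) = Complex.ofRealCLM ∘ k := by
    funext z; simp
  rw [hfun, h]
  simp

/-- **Nevanlinna's lemma, holomorphic case**: a function `φ` holomorphic on the closed disc
`|z| ≤ R` (and not identically zero) is a quotient `φ = v/u` of two functions holomorphic on the
open disc with `u(0) = 1` and `sup |u|, sup |v| ≤ exp(⨍ log⁺|φ|)` — take `u = exp(m − S)`
with `S` the Schwarz integral of `log⁺|φ|` and `m` its mean. (Cf. Nevanlinna; Goluzin.)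
[folklore] -/
theorem exists_quotient_rep_of_analyticOnNhd {φ : ℂ → ℂ} {R : ℝ} (hR : 0 < R)
    (hφ : AnalyticOnNhd ℂ φ (closedBall (0 : ℂ) R))
    (hφ' : ∀ u ∈ closedBall (0 : ℂ) R, meromorphicOrderAt φ u ≠ ⊤) :
    ∃ u v : ℂ → ℂ, DifferentiableOn ℂ u (ball (0 : ℂ) R) ∧ DifferentiableOn ℂ v (ball (0 : ℂ) R) ∧
      u 0 = 1 ∧ (∀ z ∈ ball (0 : ℂ) R, u z ≠ 0) ∧ (∀ z ∈ ball (0 : ℂ) R, v z = φ z * u z) ∧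
      ∀ z ∈ ball (0 : ℂ) R,
        ‖u z‖ ≤ Real.exp (circleAverage (fun z => log⁺ ‖φ z‖) 0 R) ∧
        ‖v z‖ ≤ Real.exp (circleAverage (fun z => log⁺ ‖φ z‖) 0 R) := by
  set k : ℂ → ℝ := fun z => log⁺ ‖φ z‖ with hk
  set mR : ℝ := circleAverage k 0 R with hmR
  have hφc : ContinuousOn φ (closedBall (0 : ℂ) R) := hφ.continuousOn
  have hkc : ContinuousOn k (closedBall (0 : ℂ) R) :=
    continuous_posLog.comp_continuousOn hφc.norm
  have hks : ContinuousOn k (sphere (0 : ℂ) R) := hkc.mono sphere_subset_closedBall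
  have hk0 : ∀ z ∈ sphere (0 : ℂ) R, 0 ≤ k z := fun z _ => posLog_nonneg
  set S := schwarzIntegral k R with hS
  refine ⟨fun z => Complex.exp (mR - S z), fun z => φ z * Complex.exp (mR - S z), ?_, ?_, ?_,
    ?_, ?_, ?_⟩
  · exact ((differentiableOn_const _).sub (differentiableOn_schwarzIntegral hR hks)).cexp
  · exact (hφ.differentiableOn.mono ball_subset_closedBall).mul
      ((differentiableOn_const _).sub (differentiableOn_schwarzIntegral hR hks)).cexp
  · simp only [hS, schwarzIntegral_zero hR hks, ← hmR, sub_self, Complex.exp_zero]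
  · exact fun z _ => Complex.exp_ne_zero _
  · exact fun z _ => rfl
  · intro z hz
    have hre : 0 ≤ (S z).re := re_schwarzIntegral_nonneg hR hks hk0 hz
    have hu : ‖Complex.exp (mR - S z)‖ ≤ Real.exp mR := by
      rw [Complex.norm_exp, Complex.sub_re, Complex.ofReal_re]
      exact Real.exp_le_exp.mpr (by linarith)
    refine ⟨hu, ?_⟩
    rw [norm_mul, Complex.norm_exp, Complex.sub_re, Complex.ofReal_re]
    -- `‖φ z‖ ≤ exp (Re S z)` by Poisson–Jensen and `log ≤ log⁺`
    have hφz : ‖φ z‖ ≤ Real.exp ((S z).re) := by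
      by_cases h0 : φ z = 0
      · rw [h0, norm_zero]; exact (Real.exp_pos _).le
      have h1 := log_norm_le_circleAverage_of_analyticOnNhd hφ hφ' hz h0
      have h2 : circleAverage ((Complex.re ∘ herglotzRieszKernel 0 z) * (Real.log ‖φ ·‖)) 0 R ≤
          circleAverage (fun x => (herglotzRieszKernel 0 z x).re * k x) 0 R := by
        have hKcont : ContinuousOn (Complex.re ∘ herglotzRieszKernel 0 z) (sphere (0 : ℂ) |R|) := by
          have hsphere : ∀ x ∈ sphere (0 : ℂ) |R|, x - z ≠ 0 := by
            intro x hx h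
            have hx' : ‖x‖ = R := by simpa [abs_of_pos hR] using hx
            have hz' : ‖z‖ < R := by simpa using hz
            rw [sub_eq_zero] at h; rw [h] at hx'; linarith
          simp only [herglotzRieszKernel_fun_def, sub_zero]
          refine Complex.continuous_re.comp_continuousOn ?_
          exact (continuousOn_id.add continuousOn_const).div
            (continuousOn_id.sub continuousOn_const) hsphere
        refine circleAverage_mono ?_ ?_ fun x hx => ?_
        · have hl : CircleIntegrable (Real.log ‖φ ·‖) 0 R := by
            apply MeromorphicOn.circleIntegrable_log_norm
            apply (hφ.mono _).meromorphicOn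
            rw [abs_of_pos hR]
            exact sphere_subset_closedBall
          unfold CircleIntegrable at hl ⊢
          have h2 : ContinuousOn (fun θ : ℝ => (Complex.re ∘ herglotzRieszKernel 0 z)
              (circleMap 0 R θ)) (Set.uIcc 0 (2 * π)) := by
            refine hKcont.comp_continuous (continuous_circleMap 0 R) (fun θ => ?_) |>.continuousOn
            simp [abs_of_pos hR]
          exact hl.continuousOn_mul h2
        · apply ContinuousOn.circleIntegrable'
          exact ContinuousOn.mul hKcont (by rwa [abs_of_pos hR])
        · rw [abs_of_pos hR] at hx
          simp only [Pi.mul_apply, Function.comp_apply]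
          refine mul_le_mul_of_nonneg_left ?_ ?_
          · simp only [hk, posLog_apply]; exact le_max_right _ _
          · have h := le_re_herglotzRieszKernel (c := 0) hx hz
            simp only [sub_zero] at h
            rw [herglotzRieszKernel_def]
            simp only [sub_zero]
            refine le_trans ?_ h
            have hz' : ‖z‖ < R := by simpa using hz
            exact div_nonneg (by linarith) (by positivity)
      rw [← re_schwarzIntegral hR hks hz] at h2
      calc ‖φ z‖ = Real.exp (Real.log ‖φ z‖) := by rw [Real.exp_log (norm_pos_iff.mpr h0)]
        _ ≤ Real.exp ((S z).re) := Real.exp_le_exp.mpr (h1.trans h2)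
    calc ‖φ z‖ * Real.exp (mR - (S z).re) ≤ Real.exp ((S z).re) * Real.exp (mR - (S z).re) := by
          gcongr
      _ = Real.exp mR := by rw [← Real.exp_add]; ring_nf


/-! ### Nevanlinna's lemma, meromorphic case -/

/-- **Nevanlinna's lemma** (meromorphic case): let `φ = ψ/χ` with `ψ, χ` holomorphic on the
closed disc `|z| ≤ R`, neither identically zero, `χ(0) ≠ 0` and `χ ≠ 0` on `|z| = R`. Then
`φ = v/u` near `0` for two functions `u, v` holomorphic on `|z| < R` with `u(0) = 1` and
`|u|, |v| ≤ exp(T)`, `T = ⨍_{|z|=R} log⁺|φ| + Σ_{poles ρ, |ρ|<R} mult(ρ) log(R/|ρ|)` (take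
`u = B/B(0) · exp(m − S)`, `B` the Blaschke product of the poles, `S` the Schwarz integral of
`log⁺|φ|`). (Cf. Nevanlinna; Goluzin, Ch. VII.) [folklore] -/
theorem exists_quotient_rep_of_meromorphic {ψ χ : ℂ → ℂ} {R : ℝ} (hR : 0 < R)
    (hψ : AnalyticOnNhd ℂ ψ (closedBall (0 : ℂ) R)) (hχ : AnalyticOnNhd ℂ χ (closedBall (0 : ℂ) R))
    (hψ' : ∀ u ∈ closedBall (0 : ℂ) R, meromorphicOrderAt ψ u ≠ ⊤)
    (hχ' : ∀ u ∈ closedBall (0 : ℂ) R, meromorphicOrderAt χ u ≠ ⊤)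
    (hχ0 : χ 0 ≠ 0) (hχS : ∀ z ∈ sphere (0 : ℂ) R, χ z ≠ 0) :
    ∃ u v : ℂ → ℂ, DifferentiableOn ℂ u (ball (0 : ℂ) R) ∧ DifferentiableOn ℂ v (ball (0 : ℂ) R) ∧
      u 0 = 1 ∧ (∀ᶠ z in 𝓝 (0 : ℂ), ψ z / χ z = v z / u z) ∧
      ∀ z ∈ ball (0 : ℂ) R,
        ‖u z‖ ≤ Real.exp (circleAverage (fun z => log⁺ ‖ψ z / χ z‖) 0 R +
          ∑ᶠ x, ((MeromorphicOn.divisor (ψ / χ) (closedBall (0 : ℂ) R) x)⁻ : ℤ) *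
            Real.log (R / ‖x‖)) ∧
        ‖v z‖ ≤ Real.exp (circleAverage (fun z => log⁺ ‖ψ z / χ z‖) 0 R +
          ∑ᶠ x, ((MeromorphicOn.divisor (ψ / χ) (closedBall (0 : ℂ) R) x)⁻ : ℤ) *
            Real.log (R / ‖x‖)) := by
  classical
  set U := closedBall (0 : ℂ) R with hU
  set φ : ℂ → ℂ := ψ / χ with hφdef
  have hφap : ∀ z, φ z = ψ z / χ z := fun z => rfl
  have h0U : (0 : ℂ) ∈ U := by simp [hU, hR.le]
  have hφU : MeromorphicOn φ U := fun z hz => (hψ z hz).meromorphicAt.div (hχ z hz).meromorphicAt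
  have h₂φ : ∀ u : U, meromorphicOrderAt φ u ≠ ⊤ := by
    intro ⟨u, hu⟩
    rw [hφdef, meromorphicOrderAt_div (hψ u hu).meromorphicAt (hχ u hu).meromorphicAt]
    have h1 := hψ' u hu
    have h2 := hχ' u hu
    -- difference of finite orders is finite
    lift meromorphicOrderAt ψ u to ℤ using h1 with a
    lift meromorphicOrderAt χ u to ℤ using h2 with b
    rw [sub_eq_add_neg, ← WithTop.LinearOrderedAddCommGroup.coe_neg, ← WithTop.coe_add]
    exact WithTop.coe_ne_top
  -- analyticity of `φ` off the zeros of `χ`, and the sign of the divisor there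
  have hφan : ∀ z ∈ U, χ z ≠ 0 → AnalyticAt ℂ φ z := fun z hz hχz =>
    (hψ z hz).div (hχ z hz) hχz
  set D := MeromorphicOn.divisor φ U with hDdef
  have hD : D.support.Finite := D.finiteSupport (isCompact_closedBall 0 R)
  have hDan : ∀ z ∈ U, χ z ≠ 0 → 0 ≤ D z := by
    intro z hz hχz
    rw [hDdef, MeromorphicOn.divisor_apply hφU hz, WithTop.untop₀_nonneg]
    exact (hφan z hz hχz).meromorphicOrderAt_nonneg
  obtain ⟨g, h₁g, h₂g, h₃g⟩ := hφU.extract_zeros_poles h₂φ hD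
  set s := hD.toFinset with hs
  set sneg := s.filter (fun u => D u < 0) with hsneg
  set spos := s.filter (fun u => 0 < D u) with hspos
  set nn : ℂ → ℕ := fun u => (-D u).toNat with hnn
  set pp : ℂ → ℕ := fun u => (D u).toNat with hpp
  have hsU : ∀ u ∈ s, u ∈ U := fun u hu => by
    rw [hs, Set.Finite.mem_toFinset] at hu
    exact D.supportWithinDomain hu
  -- poles are inside the disc and away from `0`
  have hneg : ∀ u ∈ sneg, ‖u‖ < R ∧ u ≠ 0 := by
    intro u hu
    rw [hsneg, Finset.mem_filter] at hu
    obtain ⟨hus, hDu⟩ := hu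
    have huU := hsU u hus
    have hχu : χ u = 0 := by
      by_contra h
      exact absurd (hDan u huU h) (not_le.mpr hDu)
    refine ⟨?_, ?_⟩
    · have hle : ‖u‖ ≤ R := by simpa [hU] using huU
      rcases hle.lt_or_eq with h | h
      · exact h
      · exact absurd hχu (hχS u (by simpa using h))
    · rintro rfl; exact hχ0 hχu
  have hnegR : ∀ u ∈ sneg, ‖u‖ < R := fun u hu => (hneg u hu).1
  have hneg0 : ∀ u ∈ sneg, u ≠ 0 := fun u hu => (hneg u hu).2
  -- the Blaschke product of the poles and the holomorphic numerator `F`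
  set P : ℂ → ℂ := blaschkeProd R sneg nn with hP
  set F : ℂ → ℂ := fun z => g z * (∏ u ∈ spos, (z - u) ^ pp u) *
    ∏ u ∈ sneg, ((R : ℂ) / ((R : ℂ) ^ 2 - conj u * z)) ^ nn u with hF
  have hFan : ∀ z ∈ U, AnalyticAt ℂ F z := by
    intro z hz
    have hz' : ‖z‖ ≤ R := by simpa [hU] using hz
    refine ((h₁g z hz).mul ?_).mul ?_
    · have : (fun z => ∏ u ∈ spos, (z - u) ^ pp u) = ∏ u ∈ spos, fun z => (z - u) ^ pp u := by
        funext z; simp [Finset.prod_apply]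
      rw [this]
      exact Finset.analyticAt_prod _ fun u _ => (analyticAt_id.sub analyticAt_const).pow _
    · have : (fun z => ∏ u ∈ sneg, ((R : ℂ) / ((R : ℂ) ^ 2 - conj u * z)) ^ nn u) =
          ∏ u ∈ sneg, fun z => ((R : ℂ) / ((R : ℂ) ^ 2 - conj u * z)) ^ nn u := by
        funext z; simp [Finset.prod_apply]
      rw [this]
      refine Finset.analyticAt_prod _ fun u hu => ?_
      exact (analyticAt_const.div (analyticAt_const.sub (analyticAt_const.mul analyticAt_id))
        (blaschkeDen_ne_zero (hnegR u hu) hz')).pow _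
  have hFU : AnalyticOnNhd ℂ F U := hFan
  -- the factorisation `φ = F / P` off `s`
  have hfact : ∀ z ∈ U, z ∉ s → (∏ᶠ u, (z - u) ^ D u) * g z = F z / P z := by
    intro z hz hzs
    have hz' : ‖z‖ ≤ R := by simpa [hU] using hz
    have hzu : ∀ u ∈ s, z - u ≠ 0 := fun u hu h => hzs (by rw [sub_eq_zero] at h; rwa [h])
    have hprod : ∏ᶠ u, (z - u) ^ D u = ∏ u ∈ s, (z - u) ^ D u := by
      apply finprod_eq_prod_of_mulSupport_subset
      intro u hu
      rw [Function.mem_mulSupport] at hu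
      rw [Finset.mem_coe, hs, Set.Finite.mem_toFinset]
      intro hDu
      apply hu
      rw [hDu, zpow_zero]
    -- split `s` into zeros, poles (and points with `D u = 0`, contributing `1`)
    have hsplit : ∏ u ∈ s, (z - u) ^ D u =
        (∏ u ∈ spos, (z - u) ^ pp u) * ∏ u ∈ sneg, ((z - u) ^ nn u)⁻¹ := by
      have h1 : ∀ u ∈ s, (z - u) ^ D u =
          (if 0 < D u then (z - u) ^ pp u else 1) * (if D u < 0 then ((z - u) ^ nn u)⁻¹ else 1) := by
        intro u hu
        rcases lt_trichotomy (D u) 0 with h | h | h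
        · rw [if_neg (not_lt.mpr h.le), if_pos h, one_mul, hnn]
          simp only
          rw [← zpow_natCast, Int.toNat_of_nonneg (by omega), zpow_neg, inv_inv]
        · rw [h, if_neg (lt_irrefl _), if_neg (lt_irrefl _), zpow_zero, one_mul]
        · rw [if_pos h, if_neg (not_lt.mpr h.le), mul_one, hpp]
          simp only
          rw [← zpow_natCast, Int.toNat_of_nonneg h.le]
      rw [Finset.prod_congr rfl h1, Finset.prod_mul_distrib, Finset.prod_ite, Finset.prod_ite]
      simp only [Finset.prod_const_one, mul_one]
      rfl
    have hPz : P z = (∏ u ∈ sneg, ((R : ℂ) / ((R : ℂ) ^ 2 - conj u * z)) ^ nn u) *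
        ∏ u ∈ sneg, (z - u) ^ nn u := by
      rw [hP, blaschkeProd, ← Finset.prod_mul_distrib]
      refine Finset.prod_congr rfl fun u hu => ?_
      rw [← mul_pow]
      congr 1
      have hden : (R : ℂ) ^ 2 - conj u * z ≠ 0 :=
        blaschkeDen_ne_zero (hnegR u (Finset.mem_filter.mp hu |>.1 |> fun h => by
          exact Finset.mem_filter.mpr ⟨h, (Finset.mem_filter.mp hu).2⟩)) hz'
      field_simp
    have hden2 : ∏ u ∈ sneg, (z - u) ^ nn u ≠ 0 :=
      Finset.prod_ne_zero_iff.mpr fun u hu => pow_ne_zero _ (hzu u (Finset.mem_filter.mp hu).1)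
    have hden3 : ∏ u ∈ sneg, ((R : ℂ) / ((R : ℂ) ^ 2 - conj u * z)) ^ nn u ≠ 0 := by
      refine Finset.prod_ne_zero_iff.mpr fun u hu => pow_ne_zero _ ?_
      exact div_ne_zero (by exact_mod_cast hR.ne')
        (blaschkeDen_ne_zero (hnegR u hu) hz')
    rw [hprod, hsplit, hPz, hF, Finset.prod_inv_distrib]
    beta_reduce
    set A := ∏ u ∈ sneg, ((R : ℂ) / ((R : ℂ) ^ 2 - conj u * z)) ^ nn u with hA
    set B := ∏ u ∈ sneg, (z - u) ^ nn u with hB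
    set SP := ∏ u ∈ spos, (z - u) ^ pp u with hSP
    field_simp
  -- (C) `φ = F / P` codiscretely on `U`, hence near the interior point `0`
  have hDfin : (D : ℂ → ℤ).HasFiniteSupport := hD
  have hscod : ((s : Set ℂ))ᶜ ∈ codiscreteWithin U := compl_finite_mem_codiscreteWithin s.finite_toSet
  have hcod : ∀ᶠ z in codiscreteWithin U, φ z = F z / P z := by
    filter_upwards [h₃g, hscod, self_mem_codiscreteWithin U] with z hz hzs hzU
    rw [hz, Pi.smul_apply', smul_eq_mul, Function.FactorizedRational.finprod_eq_fun hDfin]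
    exact hfact z hzU hzs
  have h0int : U ∈ 𝓝 (0 : ℂ) := by rw [hU]; exact closedBall_mem_nhds 0 hR
  have hP0 : P 0 ≠ 0 := blaschkeProd_zero_ne_zero hR hnegR hneg0
  have hPan : ∀ z ∈ U, AnalyticAt ℂ P z := fun z hz =>
    analyticAt_blaschkeProd hnegR (by simpa [hU] using hz)
  have hnhds : ∀ᶠ z in 𝓝 (0 : ℂ), φ z = F z / P z := by
    have h1 : ∀ᶠ z in 𝓝[≠] (0 : ℂ), φ z = F z / P z := by
      have h := (mem_codiscreteWithin_iff_forall_mem_nhdsNE.mp hcod) 0 h0U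
      filter_upwards [h, mem_nhdsWithin_of_mem_nhds h0int] with z hz hzU
      rcases hz with h | h
      · exact h
      · exact absurd hzU h
    have hφa0 : AnalyticAt ℂ φ 0 := hφan 0 h0U hχ0
    have hFPa0 : AnalyticAt ℂ (fun z => F z / P z) 0 := (hFan 0 h0U).div (hPan 0 h0U) hP0
    exact (hφa0.continuousAt.eventuallyEq_nhds_iff_eventuallyEq_nhdsNE hFPa0.continuousAt).mp h1
  -- (D) the Schwarz integral of `log⁺|φ|`
  set k : ℂ → ℝ := fun z => log⁺ ‖φ z‖ with hk
  set mR : ℝ := circleAverage k 0 R with hmR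
  have hsphU : sphere (0 : ℂ) R ⊆ U := by rw [hU]; exact sphere_subset_closedBall
  have hφcs : ContinuousOn φ (sphere (0 : ℂ) R) := by
    rw [hφdef]
    exact (hψ.continuousOn.mono hsphU).div (hχ.continuousOn.mono hsphU) hχS
  have hks : ContinuousOn k (sphere (0 : ℂ) R) := continuous_posLog.comp_continuousOn hφcs.norm
  have hk0 : ∀ z ∈ sphere (0 : ℂ) R, 0 ≤ k z := fun z _ => posLog_nonneg
  set S := schwarzIntegral k R with hS
  -- the counting term
  set N : ℝ := ∑ u ∈ sneg, (nn u : ℝ) * Real.log (R / ‖u‖) with hN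
  have hPnorm0 : Real.log ‖P 0‖ = -N := by
    rw [hP, log_norm_blaschkeProd_zero hR hneg0, hN]
  have hP0exp : ‖P 0‖ = Real.exp (-N) := by
    rw [← hPnorm0, Real.exp_log (norm_pos_iff.mpr hP0)]
  have hNsum : ∑ᶠ x, ((D x)⁻ : ℤ) * Real.log (R / ‖x‖) = N := by
    rw [hN, finsum_eq_sum_of_support_subset (s := sneg)]
    · refine Finset.sum_congr rfl fun u hu => ?_
      have hDu : D u < 0 := (Finset.mem_filter.mp hu).2
      congr 1
      rw [hnn]
      simp only
      have h1 : ((D u)⁻ : ℤ) = -D u := negPart_eq_neg.mpr hDu.le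
      have h2 : (((-D u).toNat : ℕ) : ℤ) = -D u := Int.toNat_of_nonneg (by omega)
      rw [h1]
      have h3 : (((-D u : ℤ)) : ℝ) = (((-D u).toNat : ℕ) : ℝ) := by exact_mod_cast h2.symm
      exact h3
    · intro u hu
      rw [Function.mem_support] at hu
      rw [Finset.mem_coe, hsneg, Finset.mem_filter, hs, Set.Finite.mem_toFinset]
      by_contra hcon
      apply hu
      have : (D u)⁻ = 0 := by
        rw [negPart_eq_zero]
        by_contra hlt
        push Not at hlt
        exact hcon ⟨Function.mem_support.mpr (by omega), hlt⟩
      rw [this]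
      simp
  -- (E) `F` has finite order everywhere on `U`
  have hF' : ∀ u ∈ U, meromorphicOrderAt F u ≠ ⊤ := by
    intro u hu
    rw [meromorphicOrderAt_ne_top_iff_eventually_ne_zero (hFan u hu).meromorphicAt]
    have e1 : ∀ᶠ z in 𝓝 u, g z ≠ 0 := (h₁g u hu).continuousAt.eventually_ne (h₂g ⟨u, hu⟩)
    have e2 : ∀ᶠ z in 𝓝 u, ∀ x ∈ sneg, (R : ℂ) ^ 2 - conj x * z ≠ 0 := by
      rw [Filter.eventually_all_finset]
      intro x hx
      have hc : ContinuousAt (fun z => (R : ℂ) ^ 2 - conj x * z) u := by fun_prop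
      exact hc.eventually_ne (blaschkeDen_ne_zero (hnegR x hx) (by simpa [hU] using hu))
    have e3 : ∀ᶠ z in 𝓝[≠] u, z ∉ spos := by
      have hT : IsClosed (((spos : Set ℂ)) \ {u}) := (spos.finite_toSet.subset fun x hx => hx.1).isClosed
      have huT : u ∉ ((spos : Set ℂ)) \ {u} := fun h => h.2 rfl
      have hmem : (((spos : Set ℂ)) \ {u})ᶜ ∈ 𝓝 u := hT.isOpen_compl.mem_nhds huT
      filter_upwards [mem_nhdsWithin_of_mem_nhds hmem, self_mem_nhdsWithin] with z hz hzu
      intro hzs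
      exact hz ⟨hzs, hzu⟩
    filter_upwards [eventually_nhdsWithin_of_eventually_nhds e1,
      eventually_nhdsWithin_of_eventually_nhds e2, e3] with z hz1 hz2 hz3
    rw [hF]
    refine mul_ne_zero (mul_ne_zero hz1 ?_) ?_
    · exact Finset.prod_ne_zero_iff.mpr fun x hx => pow_ne_zero _ (sub_ne_zero.mpr
        (by rintro rfl; exact hz3 hx))
    · exact Finset.prod_ne_zero_iff.mpr fun x hx => pow_ne_zero _
        (div_ne_zero (by exact_mod_cast hR.ne') (hz2 x hx))
  -- (F) on the circle, `|F| = |φ|` codiscretely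
  have hcodS : (fun z => Real.log ‖F z‖) =ᶠ[codiscreteWithin (sphere (0 : ℂ) |R|)]
      fun z => Real.log ‖φ z‖ := by
    have h1 : ∀ᶠ z in codiscreteWithin (sphere (0 : ℂ) |R|), φ z = F z / P z := by
      refine codiscreteWithin_mono ?_ hcod
      rw [abs_of_pos hR]; exact hsphU
    filter_upwards [h1, self_mem_codiscreteWithin _] with z hz hzS
    rw [abs_of_pos hR] at hzS
    have hzR : ‖z‖ = R := by simpa using hzS
    have hPz : ‖P z‖ = 1 := norm_blaschkeProd_eq_one hR hnegR hzR
    have hPz0 : P z ≠ 0 := fun h => by rw [h, norm_zero] at hPz; exact zero_ne_one hPz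
    have : F z = φ z * P z := by rw [hz, div_mul_cancel₀ _ hPz0]
    rw [this, norm_mul, hPz, mul_one]
  -- (G) `|F w| ≤ exp (Re S w)` inside
  have hKcont : ∀ {w : ℂ}, w ∈ ball (0 : ℂ) R →
      ContinuousOn (Complex.re ∘ herglotzRieszKernel 0 w) (sphere (0 : ℂ) |R|) := by
    intro w hw
    have hsphere : ∀ x ∈ sphere (0 : ℂ) |R|, x - w ≠ 0 := by
      intro x hx h
      have hx' : ‖x‖ = R := by simpa [abs_of_pos hR] using hx
      have hw' : ‖w‖ < R := by simpa using hw
      rw [sub_eq_zero] at h; rw [h] at hx'; linarith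
    simp only [herglotzRieszKernel_fun_def, sub_zero]
    refine Complex.continuous_re.comp_continuousOn ?_
    exact (continuousOn_id.add continuousOn_const).div (continuousOn_id.sub continuousOn_const)
      hsphere
  have hFle : ∀ w ∈ ball (0 : ℂ) R, ‖F w‖ ≤ Real.exp ((S w).re) := by
    intro w hw
    by_cases hF0 : F w = 0
    · rw [hF0, norm_zero]; exact (Real.exp_pos _).le
    have h1 := log_norm_le_circleAverage_of_analyticOnNhd hFU hF' hw hF0
    set K := Complex.re ∘ herglotzRieszKernel 0 w with hK
    have hKc := hKcont hw
    have hKint : ∀ {f : ℂ → ℝ}, CircleIntegrable f 0 R → CircleIntegrable (K * f) 0 R := by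
      intro f hf
      unfold CircleIntegrable at hf ⊢
      have h2 : ContinuousOn (fun θ : ℝ => K (circleMap 0 R θ)) (Set.uIcc 0 (2 * π)) := by
        refine hKc.comp_continuous (continuous_circleMap 0 R) (fun θ => ?_) |>.continuousOn
        simp [abs_of_pos hR]
      exact hf.continuousOn_mul h2
    have h2 : circleAverage (K * fun z => Real.log ‖F z‖) 0 R =
        circleAverage (K * fun z => Real.log ‖φ z‖) 0 R := by
      apply circleAverage_congr_codiscreteWithin _ hR.ne'
      filter_upwards [hcodS] with z hz
      simp only [Pi.mul_apply, hz]
    have hlogφ : CircleIntegrable (fun z => Real.log ‖φ z‖) 0 R := by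
      apply MeromorphicOn.circleIntegrable_log_norm
      intro x hx
      rw [abs_of_pos hR] at hx
      exact hφU x (hsphU hx)
    have h3 : circleAverage (K * fun z => Real.log ‖φ z‖) 0 R ≤
        circleAverage (fun x => (herglotzRieszKernel 0 w x).re * k x) 0 R := by
      refine circleAverage_mono (hKint hlogφ) ?_ fun x hx => ?_
      · apply ContinuousOn.circleIntegrable'
        exact ContinuousOn.mul hKc (by rwa [abs_of_pos hR])
      · rw [abs_of_pos hR] at hx
        simp only [Pi.mul_apply, Function.comp_apply, hK]
        refine mul_le_mul_of_nonneg_left ?_ ?_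
        · simp only [hk, posLog_apply]; exact le_max_right _ _
        · have h := le_re_herglotzRieszKernel (c := 0) hx hw
          simp only [sub_zero] at h
          rw [herglotzRieszKernel_def]
          simp only [sub_zero]
          refine le_trans ?_ h
          have hw' : ‖w‖ < R := by simpa using hw
          exact div_nonneg (by linarith) (by positivity)
    rw [← re_schwarzIntegral hR hks hw] at h3
    have h4 : Real.log ‖F w‖ ≤ (S w).re := by
      have := h1.trans (le_of_eq h2)
      exact this.trans h3
    calc ‖F w‖ = Real.exp (Real.log ‖F w‖) := by rw [Real.exp_log (norm_pos_iff.mpr hF0)]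
      _ ≤ Real.exp ((S w).re) := Real.exp_le_exp.mpr h4
  -- (H) the quotient representation
  have hSd : DifferentiableOn ℂ S (ball (0 : ℂ) R) := differentiableOn_schwarzIntegral hR hks
  have hEd : DifferentiableOn ℂ (fun z => Complex.exp (mR - S z)) (ball (0 : ℂ) R) :=
    ((differentiableOn_const _).sub hSd).cexp
  have hPd : DifferentiableOn ℂ P (ball (0 : ℂ) R) := fun z hz =>
    (hPan z (ball_subset_closedBall hz)).differentiableAt.differentiableWithinAt
  have hFd : DifferentiableOn ℂ F (ball (0 : ℂ) R) := fun z hz =>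
    (hFan z (ball_subset_closedBall hz)).differentiableAt.differentiableWithinAt
  refine ⟨fun z => P z / P 0 * Complex.exp (mR - S z), fun z => F z / P 0 * Complex.exp (mR - S z),
    (hPd.div_const _).mul hEd, (hFd.div_const _).mul hEd, ?_, ?_, ?_⟩
  · -- `u 0 = 1`
    simp only [hS, schwarzIntegral_zero hR hks, ← hmR, sub_self, Complex.exp_zero, mul_one,
      div_self hP0]
  · -- `φ = v/u` near `0`
    have hPne : ∀ᶠ z in 𝓝 (0 : ℂ), P z ≠ 0 := (hPan 0 h0U).continuousAt.eventually_ne hP0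
    filter_upwards [hnhds, hPne] with z hz hPz
    rw [← hφap, hz]
    have hE : Complex.exp (mR - S z) ≠ 0 := Complex.exp_ne_zero _
    field_simp
  · -- the bounds
    intro z hz
    have hz' : ‖z‖ ≤ R := le_of_lt (by simpa using hz)
    have hre : 0 ≤ (S z).re := re_schwarzIntegral_nonneg hR hks hk0 hz
    have hexp : ‖Complex.exp (mR - S z)‖ = Real.exp (mR - (S z).re) := by
      rw [Complex.norm_exp, Complex.sub_re, Complex.ofReal_re]
    rw [hNsum]
    constructor
    · rw [norm_mul, norm_div, hexp, hP0exp]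
      have hPz : ‖P z‖ ≤ 1 := norm_blaschkeProd_le_one hR hnegR hz'
      calc ‖P z‖ / Real.exp (-N) * Real.exp (mR - (S z).re)
          ≤ 1 / Real.exp (-N) * Real.exp mR := by
            gcongr
            linarith
        _ = Real.exp (mR + N) := by
            rw [Real.exp_neg, one_div, inv_inv, Real.exp_add]; ring
    · rw [norm_mul, norm_div, hexp, hP0exp]
      calc ‖F z‖ / Real.exp (-N) * Real.exp (mR - (S z).re)
          ≤ Real.exp ((S z).re) / Real.exp (-N) * Real.exp (mR - (S z).re) := by
            gcongr
            exact hFle z hz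
        _ = Real.exp (mR + N) := by
            rw [Real.exp_neg, div_eq_mul_inv, inv_inv, ← Real.exp_add, ← Real.exp_add]
            ring_nf

end HolonomyBound

end Literature.NumberTheory.Transcendental
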